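import Literature.MathematicalPhysics.QuantumLattice.XYMessagerMiracleSole
import Summits.HubbardSuperconductivity.HubbardSuperconductivity.Theorems.LevyLogBootstrapBlock2InfDivXXZGriffithsTriangle
import HarnessLib

/-!
# Crux `Block2InfDivXXZ` (stmt-HubbardSuperconductivity-15048, route `LevyLogBootstrap`):
# reflection and axis monotonicity of the XY torus ground-state kernel (`Δ = 0`)

Support file (registered sub-goals `gs_transverseKernel_reflect_le`, `gs_transverseKernel_axisStep_le`);
companion of `…GriffithsTriangle.lean` (Griffiths–Ginibre triangle inequality). For even `M ≥ 4`,
the normalised `S³_tot = 0` sector ground state `ψ` of `H_M(0) = xxzHamiltonian 1 (torusGraph 2 M) (-1) 0`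
and its transverse kernel `K(x,y) = Re⟨ψ, S⁺_x S⁻_y ψ⟩`:

* `gs_transverseKernel_reflect_le` — **Messager–Miracle-Solé reflection monotonicity**
  `K(x, θy) ≤ K(x, y)` for `x, y` on one side of a bond-plane reflection `θ` (the new Literature
  theorem `xy_re_groundState_reflect_le`: quantum-XY MMS inequality by Ginibre doubling of the two
  halves of the torus in the Benassi–Lees–Ueltschi basis; uniqueness of the ground state;
  `K = 2⟨SˣSˣ⟩` on the sector);
* `gs_transverseKernel_axisStep_le` — **axis monotonicity**: `K(0, y + e_j) ≤ K(0, y)` whenever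
  `y ≠ 0`, `y_j = t`, `t + 1 ≤ M/2` — the kernel is non-increasing in each coordinate from `0` to
  the antipode (MMS across the bond plane between layers `t` and `t+1`; `axisStep_geometry`).

This is the monotonicity that input (c) of `LevyTransport` (stmt-15049) expected "by reflection
positivity"; RP does not give it, Griffiths/Ginibre structure does — at `Δ = 0`. For
`Δ ∈ [-1, 0)` it is an open conjecture (numerically true on every kernel held: evidence
`EVIDENCE-griffiths-metric-w12.md`). No definition is introduced; sorry-free.
-/

-- the mandated namespace `Summit.<Summit>.<Problem>.Theorems` repeats `HubbardSuperconductivity`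
set_option linter.dupNamespace false

noncomputable section

namespace Summit.HubbardSuperconductivity.HubbardSuperconductivity.Theorems.LevyLogBootstrap

open Matrix Complex
open Literature.MathematicalPhysics.QuantumLattice Literature.Probability.LatticeModels

section Torus

variable (M : ℕ) [NeZero M]

/-- The half-filled sector ground state of `H_M(0)` spans the ground space and the ground state is
unique (even `M ≥ 4`). [folklore] -/
theorem xxzTorus_zero_unique_gs (hM : Even M) (h4 : 4 ≤ M)
    {ψ : TensorIndex (TorusSite 2 M) 2 → ℂ}
    (heig : Matrix.mulVec (xxzHamiltonian 1 (torusGraph 2 M) (-1) 0) ψ =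
      ((lowestEnergyInSector 1 (xxzHamiltonian 1 (torusGraph 2 M) (-1) 0) 0 : ℝ) : ℂ) • ψ) :
    (xxzHamiltonian 1 (torusGraph 2 M) (-1) 0).HasUniqueGroundState ∧
      ψ ∈ (xxzHamiltonian 1 (torusGraph 2 M) (-1) 0).groundSpace := by
  set H : Op (TorusSite 2 M) 2 := xxzHamiltonian 1 (torusGraph 2 M) (-1) 0 with hHdef
  obtain ⟨φ, hφ0, -, hspan, hEsec⟩ := xxzTorus_groundSpace_eq_span M hM h4 (le_refl (0 : ℝ))
  refine ⟨?_, ?_⟩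
  · change Module.finrank ℂ H.groundSpace = 1
    rw [hspan]
    exact finrank_span_singleton hφ0
  · rw [mem_groundSpace_iff, ← hEsec]; exact heig

/-- **Registered sub-goal `gs_transverseKernel_reflect_le` (crux `Block2InfDivXXZ`, `Δ = 0`):
Messager–Miracle-Solé reflection monotonicity of the transverse kernel of the XY torus ground
state.** For even `M ≥ 4`, the normalised `S³_tot = 0` sector ground state `ψ` of `H_M(0)`, a
bond-plane reflection `θ = Torus.reflectBetweenSites j c` and sites `x, y` of its left half with
`x ≠ y`, `x ≠ θy`: `K(x, θy) ≤ K(x, y)`, `K(x,y) = Re⟨ψ, S⁺_x S⁻_y ψ⟩`. Quantum-XY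
Messager–Miracle-Solé inequality (`Literature.….xy_re_groundState_reflect_le`) + uniqueness +
`K = 2⟨SˣSˣ⟩` on the sector.
[cite: MessagerMiracleSoleJSP1977, Thm. 1 (quantum XY analogue)] -/
theorem gs_transverseKernel_reflect_le (hM : Even M) (h4 : 4 ≤ M)
    (ψ : TensorIndex (TorusSite 2 M) 2 → ℂ)
    (hψ : ψ ∈ spinZSector (Λ := TorusSite 2 M) 1 0) (hnorm : star ψ ⬝ᵥ ψ = 1)
    (heig : Matrix.mulVec (xxzHamiltonian 1 (torusGraph 2 M) (-1) 0) ψ =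
      ((lowestEnergyInSector 1 (xxzHamiltonian 1 (torusGraph 2 M) (-1) 0) 0 : ℝ) : ℂ) • ψ)
    (j : Fin 2) (c : ZMod M) {x y : TorusSite 2 M} (hx : x ∈ torusLeftHalf M j c)
    (hy : y ∈ torusLeftHalf M j c) (hxy : x ≠ y) (hxθy : x ≠ Torus.reflectBetweenSites j c y) :
    (star ψ ⬝ᵥ (onSite x (spinRaise 1) * onSite (Torus.reflectBetweenSites j c y) (spinLower 1)) *ᵥ ψ).re ≤
      (star ψ ⬝ᵥ (onSite x (spinRaise 1) * onSite y (spinLower 1)) *ᵥ ψ).re := by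
  obtain ⟨hU, hψG⟩ := xxzTorus_zero_unique_gs M hM h4 heig
  have h := xy_re_groundState_reflect_le M j c hM hU hψG hnorm hx hy
  rw [re_expect_raiseLower_eq_two_mul_spinX hψ hxθy,
    re_expect_raiseLower_eq_two_mul_spinX hψ hxy]
  linarith

/-- Geometry of the axis step: with `c = t + M/2` (`t + 1 ≤ M/2`, `M` even), the reflection
`θ = Torus.reflectBetweenSites j c` maps a site `y` with `y j = t` to `y + e_j`, and both `0` and
`y` lie in the left half of `θ`. [folklore] -/
theorem axisStep_geometry (hM : Even M) {t : ℕ} (ht : t + 1 ≤ M / 2) (j : Fin 2)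
    {y : TorusSite 2 M} (hyj : y j = (t : ZMod M)) :
    Torus.reflectBetweenSites j (((t + M / 2 : ℕ)) : ZMod M) y = y + Pi.single j 1 ∧
      (0 : TorusSite 2 M) ∈ torusLeftHalf M j (((t + M / 2 : ℕ)) : ZMod M) ∧
      y ∈ torusLeftHalf M j (((t + M / 2 : ℕ)) : ZMod M) := by
  have h2 : 2 * (M / 2) = M := Nat.two_mul_div_two_of_even hM
  have hMz : ((M : ℕ) : ZMod M) = 0 := ZMod.natCast_self M
  -- `M/2 + M/2 = 0` in `ℤ/M`
  have hhalf : ((M / 2 : ℕ) : ZMod M) + ((M / 2 : ℕ) : ZMod M) = 0 := by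
    rw [← Nat.cast_add, ← two_mul, h2, hMz]
  -- the two complements, without truncated subtraction
  obtain ⟨u, hu⟩ : ∃ u : ℕ, u + t + 1 = M / 2 := ⟨M / 2 - t - 1, by omega⟩
  obtain ⟨v, hv⟩ : ∃ v : ℕ, v + 1 = M / 2 := ⟨M / 2 - 1, by omega⟩
  have hu' : (u : ZMod M) + t + 1 = ((M / 2 : ℕ) : ZMod M) := by
    have h := congrArg (Nat.cast (R := ZMod M)) hu
    push_cast at h
    exact h
  have hv' : (v : ZMod M) + 1 = ((M / 2 : ℕ) : ZMod M) := by
    have h := congrArg (Nat.cast (R := ZMod M)) hv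
    push_cast at h
    exact h
  refine ⟨?_, ?_, ?_⟩
  · ext l
    by_cases hl : l = j
    · subst hl
      rw [Torus.reflectBetweenSites_apply, Function.update_self, Pi.add_apply, Pi.single_eq_same,
        hyj]
      push_cast
      linear_combination hhalf
    · rw [Torus.reflectBetweenSites_apply, Function.update_of_ne hl, Pi.add_apply,
        Pi.single_eq_of_ne hl, add_zero]
  · rw [mem_torusLeftHalf]
    have e : (0 : TorusSite 2 M) j - ((((t + M / 2 : ℕ)) : ZMod M) + 1) = (u : ZMod M) := by
      rw [Pi.zero_apply, zero_sub, neg_eq_iff_eq_neg, eq_neg_iff_add_eq_zero]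
      push_cast
      linear_combination hu' + hhalf
    rw [e, ZMod.val_natCast, Nat.mod_eq_of_lt (by omega)]
    omega
  · rw [mem_torusLeftHalf, hyj]
    have e : (t : ZMod M) - ((((t + M / 2 : ℕ)) : ZMod M) + 1) = (v : ZMod M) := by
      rw [sub_eq_iff_eq_add]
      push_cast
      linear_combination -hv' - hhalf
    rw [e, ZMod.val_natCast, Nat.mod_eq_of_lt (by omega)]
    omega

/-- **Axis monotonicity of the XY torus ground-state kernel** (`Δ = 0`): for even `M ≥ 4`, the
normalised `S³_tot = 0` sector ground state `ψ` of `H_M(0)`, a direction `j` and a site `y ≠ 0`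
with `y j = t`, `t + 1 ≤ M/2`: `K(0, y + e_j) ≤ K(0, y)` — the transverse kernel is non-increasing
in each coordinate from `0` up to the antipode (Messager–Miracle-Solé across the bond plane
between layers `t` and `t + 1`). [cite: MessagerMiracleSoleJSP1977, Thm. 1 (quantum XY analogue)] -/
theorem gs_transverseKernel_axisStep_le (hM : Even M) (h4 : 4 ≤ M)
    (ψ : TensorIndex (TorusSite 2 M) 2 → ℂ)
    (hψ : ψ ∈ spinZSector (Λ := TorusSite 2 M) 1 0) (hnorm : star ψ ⬝ᵥ ψ = 1)
    (heig : Matrix.mulVec (xxzHamiltonian 1 (torusGraph 2 M) (-1) 0) ψ =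
      ((lowestEnergyInSector 1 (xxzHamiltonian 1 (torusGraph 2 M) (-1) 0) 0 : ℝ) : ℂ) • ψ)
    (j : Fin 2) {y : TorusSite 2 M} (hy0 : y ≠ 0) {t : ℕ} (ht : t + 1 ≤ M / 2)
    (hyj : y j = (t : ZMod M)) :
    (star ψ ⬝ᵥ (onSite 0 (spinRaise 1) * onSite (y + Pi.single j 1) (spinLower 1)) *ᵥ ψ).re ≤
      (star ψ ⬝ᵥ (onSite 0 (spinRaise 1) * onSite y (spinLower 1)) *ᵥ ψ).re := by
  obtain ⟨hθ, h0, hy⟩ := axisStep_geometry M hM ht j hyj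
  have hne : (0 : TorusSite 2 M) ≠ y + Pi.single j 1 := by
    intro h
    have hj := congrFun h j
    rw [Pi.zero_apply, Pi.add_apply, Pi.single_eq_same, hyj, ← Nat.cast_one, ← Nat.cast_add] at hj
    have hdvd := (ZMod.natCast_eq_zero_iff (t + 1) M).1 hj.symm
    have : t + 1 < M := by
      have := Nat.div_le_self M 2
      omega
    exact absurd (Nat.eq_zero_of_dvd_of_lt hdvd this) (by omega)
  have h := gs_transverseKernel_reflect_le M hM h4 ψ hψ hnorm heig j _ h0 hy hy0.symm
    (by rw [hθ]; exact hne)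
  rwa [hθ] at h

end Torus

/-- **Registered sub-goal `gs_transverseKernel_reflect_le_all` (crux `Block2InfDivXXZ`,
stmt-HubbardSuperconductivity-15048)**: the `∀`-closed form of `gs_transverseKernel_reflect_le` — at
the XY point `Δ = 0`, for every even torus `M ≥ 4`, every normalised `S³_tot = 0` sector ground state,
every bond-plane reflection `θ` and all `x ≠ y`, `x ≠ θy` on its left half, `K(x, θy) ≤ K(x, y)`
(Messager–Miracle-Solé reflection monotonicity of the transverse kernel).
[cite: MessagerMiracleSoleJSP1977, Thm. 1 (quantum XY analogue)] -/
theorem gs_transverseKernel_reflect_le_all :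
    ∀ (M : ℕ) [NeZero M], Even M → 4 ≤ M → ∀ (ψ : TensorIndex (TorusSite 2 M) 2 → ℂ),
      ψ ∈ @spinZSector (TorusSite 2 M) _ _ 1 0 → star ψ ⬝ᵥ ψ = 1 →
      Matrix.mulVec (xxzHamiltonian 1 (torusGraph 2 M) (-1) 0) ψ =
        ((lowestEnergyInSector 1 (xxzHamiltonian 1 (torusGraph 2 M) (-1) 0) 0 : ℝ) : ℂ) • ψ →
      ∀ (j : Fin 2) (c : ZMod M) (x y : TorusSite 2 M), x ∈ torusLeftHalf M j c →
        y ∈ torusLeftHalf M j c → x ≠ y → x ≠ Torus.reflectBetweenSites j c y →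
        (star ψ ⬝ᵥ Matrix.mulVec (onSite x (spinRaise 1) *
            onSite (Torus.reflectBetweenSites j c y) (spinLower 1)) ψ).re ≤
          (star ψ ⬝ᵥ Matrix.mulVec (onSite x (spinRaise 1) * onSite y (spinLower 1)) ψ).re :=
  fun M _ hM h4 ψ hψ hnorm heig j c _ _ hx hy hxy hxθy =>
    gs_transverseKernel_reflect_le M hM h4 ψ hψ hnorm heig j c hx hy hxy hxθy

/-- **Registered sub-goal `gs_transverseKernel_axisStep_le_all` (crux `Block2InfDivXXZ`,
stmt-HubbardSuperconductivity-15048)**: the `∀`-closed form of `gs_transverseKernel_axisStep_le` — at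
the XY point `Δ = 0`, for every even torus `M ≥ 4` and every normalised `S³_tot = 0` sector ground
state, the transverse kernel is non-increasing along each axis from `0` to the antipode:
`K(0, y + e_j) ≤ K(0, y)` for `y ≠ 0`, `y_j = t`, `t + 1 ≤ M/2`.
[cite: MessagerMiracleSoleJSP1977, Thm. 1 (quantum XY analogue)] -/
theorem gs_transverseKernel_axisStep_le_all :
    ∀ (M : ℕ) [NeZero M], Even M → 4 ≤ M → ∀ (ψ : TensorIndex (TorusSite 2 M) 2 → ℂ),
      ψ ∈ @spinZSector (TorusSite 2 M) _ _ 1 0 → star ψ ⬝ᵥ ψ = 1 →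
      Matrix.mulVec (xxzHamiltonian 1 (torusGraph 2 M) (-1) 0) ψ =
        ((lowestEnergyInSector 1 (xxzHamiltonian 1 (torusGraph 2 M) (-1) 0) 0 : ℝ) : ℂ) • ψ →
      ∀ (j : Fin 2) (y : TorusSite 2 M), y ≠ 0 → ∀ (t : ℕ), t + 1 ≤ M / 2 →
        y j = (t : ZMod M) →
        (star ψ ⬝ᵥ Matrix.mulVec (onSite 0 (spinRaise 1) *
            onSite (y + Pi.single j 1) (spinLower 1)) ψ).re ≤
          (star ψ ⬝ᵥ Matrix.mulVec (onSite 0 (spinRaise 1) * onSite y (spinLower 1)) ψ).re :=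
  fun M _ hM h4 ψ hψ hnorm heig j _ hy0 _ ht hyj =>
    gs_transverseKernel_axisStep_le M hM h4 ψ hψ hnorm heig j hy0 ht hyj

end Summit.HubbardSuperconductivity.HubbardSuperconductivity.Theorems.LevyLogBootstrap

end
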